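import Mathlib
import Literature.Analysis.FunctionSpaces.TorusTrigPoly

/-!
# Cubic coordinates for the cubic-Casimir cores of `stub_noAxialCubicCasimir`
# (stub S2c of line `axis-sectors`, crux `MomentParity.QuarticGate`, stmt-AnomalousDissipation-11464)

Infrastructure (a deliberate definition-bearing tools file) for the GENERATED base/layer
certificates of the registered cores `cubicCoreCentre` / `cubicCoreOffCentre`: a complex tensor
`Γ k₁ k₂ k₃ a b c` on wavevector triples of the punctured ball `B`, symmetric, transversal and
satisfying the polarised quartet identity, is probed through its CUBIC COORDINATES
`cub Γ l p q u v w = Σ Γ l p q a b c uₐ v_b w_c` at integer polarisations taken from a fixed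
per-wavevector basis `nb1 k, nb2 k = k × nb1 k` of `k⊥` (mirrored byte-for-byte by the generator
`compute/gen/qmodel.py` of the line lead).

* `nsqZ`, `nb1`, `nb2`, `nbv`, `cub`, `CubicHyp` (+ `CubicHyp.of_centre/of_offCentre` from the cores'
  hypothesis lists);
* `cub` algebra: `cub_swap12/23`, `cub_zero₁₂₃`, `cub_supp`, `cub_add/smul₁₂₃`, `cub_self₁₂₃`;
* `proj_identity` (orthogonal expansion along `n, l × n, l` over a commutative ring, no division) and
  the anchor `cub_expand₁` — the first-slot expansion in the `nb` basis — with its degenerate-leg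
  variant `cub_expand₁_of`.

Part 2 (`…CubicCoordPart2`) has the reconstruction lemma `cub_ext`, the written-out quartet identity
`quartet_nb`, the normalisation macros `cub_norm`/`cub_sort` of the generated steps and the ball
membership lemmas `memB_of_nsqZ`/`memB4`.

Pure finite-dimensional algebra; supports stmt-AnomalousDissipation-11464, restates nothing of it.
-/

namespace Summit.AnomalousDissipation.AnomalousDissipation.Theorems.MomentParityQuarticGate

open Matrix Literature.Analysis.FunctionSpaces

-- `Summit.<Summit>.<Problem>` is the tree's mandated summit-side namespace (CONVENTIONS §2); for this
-- single-conjunct summit the two coincide, so the duplicate is deliberate.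
set_option linter.dupNamespace false

variable {B : Finset (Fin 3 → ℤ)}
  {Γ : (Fin 3 → ℤ) → (Fin 3 → ℤ) → (Fin 3 → ℤ) → Fin 3 → Fin 3 → Fin 3 → ℂ}

/-! ## Norms, the polarisation basis, cubic coordinates -/

/-- `|k|² ∈ ℤ` of an integer wavevector. [folklore] -/
def nsqZ (k : Fin 3 → ℤ) : ℤ := k 0 ^ 2 + k 1 ^ 2 + k 2 ^ 2

/-- `Torus.freqNormSq k = ↑(nsqZ k)`. [folklore] -/
theorem freqNormSq_eq_nsqZ (k : Fin 3 → ℤ) : Torus.freqNormSq k = ((nsqZ k : ℤ) : ℝ) := by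
  simp only [Torus.freqNormSq, nsqZ, Fin.sum_univ_three]; push_cast; ring

/-- `nsqZ k = k ⬝ᵥ k`. [folklore] -/
theorem nsqZ_eq_dotProduct (k : Fin 3 → ℤ) : nsqZ k = k ⬝ᵥ k := by
  simp [nsqZ, vec3_dotProduct, sq]

/-- THE polarisation basis, first vector: a fixed nonzero integer vector `⊥ k` (axis / coordinate-plane
/ diagonal cases first, generic `(k₁, -k₀, 0)` last); must match `qmodel.py`. [folklore] -/
def nb1 (k : Fin 3 → ℤ) : Fin 3 → ℤ :=
  if k 1 = 0 ∧ k 2 = 0 then ![0, 1, 0] else if k 0 = 0 ∧ k 2 = 0 then ![1, 0, 0]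
  else if k 0 = 0 ∧ k 1 = 0 then ![1, 0, 0]
  else if k 0 = 0 then ![1, 0, 0] else if k 1 = 0 then ![0, 1, 0] else if k 2 = 0 then ![0, 0, 1]
  else if |k 0| = |k 1| then ![Int.sign (k 0), -Int.sign (k 1), 0]
  else if |k 0| = |k 2| then ![Int.sign (k 0), 0, -Int.sign (k 2)]
  else if |k 1| = |k 2| then ![0, Int.sign (k 1), -Int.sign (k 2)] else ![k 1, -k 0, 0]

/-- Second basis vector `nb2 k = k × nb1 k`. [folklore] -/
def nb2 (k : Fin 3 → ℤ) : Fin 3 → ℤ := k ⨯₃ nb1 k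

/-- `nbv 0 = nb1`, `nbv 1 = nb2`. [folklore] -/
def nbv (s : Fin 2) (k : Fin 3 → ℤ) : Fin 3 → ℤ := if s = 0 then nb1 k else nb2 k

/-- `nbv 0 k = nb1 k`. [folklore] -/
@[simp] theorem nbv_zero (k : Fin 3 → ℤ) : nbv 0 k = nb1 k := rfl

/-- `nbv 1 k = nb2 k`. [folklore] -/
@[simp] theorem nbv_one (k : Fin 3 → ℤ) : nbv 1 k = nb2 k := rfl

/-- `Int.sign` by comparison (evaluation lemma for `cub_norm`). [folklore] -/
theorem int_sign_eval (a : ℤ) : a.sign = if 0 < a then 1 else if a < 0 then -1 else 0 := by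
  rcases lt_trichotomy a 0 with h | rfl | h
  · rw [Int.sign_eq_neg_one_of_neg h, if_neg (not_lt.2 h.le), if_pos h]
  · simp
  · rw [Int.sign_eq_one_of_pos h, if_pos h]

/-- `nb1 k ⊥ k` (all `k`). [folklore] -/
theorem nb1_dotProduct (k : Fin 3 → ℤ) : nb1 k ⬝ᵥ k = 0 := by
  unfold nb1
  split_ifs <;> simp only [vec3_dotProduct, cons_val_zero, cons_val_one, cons_val_two, head_cons,
    tail_cons, neg_mul, Int.sign_mul_self, Int.natCast_natAbs, zero_mul, one_mul, add_zero,
    zero_add] <;> first | omega | ring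

/-- `nb1 k ≠ 0` (all `k`). [folklore] -/
theorem nb1_ne_zero (k : Fin 3 → ℤ) : nb1 k ≠ 0 := by
  unfold nb1
  split_ifs <;> intro h <;> simp_all

/-- `nb2 k ⊥ k`. [folklore] -/
theorem nb2_dotProduct (k : Fin 3 → ℤ) : nb2 k ⬝ᵥ k = 0 := by
  rw [nb2, dotProduct_comm]; exact dot_self_cross k (nb1 k)

/-- `nb1 k ⊥ nb2 k`. [folklore] -/
theorem nb1_dotProduct_nb2 (k : Fin 3 → ℤ) : nb1 k ⬝ᵥ nb2 k = 0 := dot_cross_self k (nb1 k)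

/-- Lagrange: `|k × n|² = |k|² |n|²` for `n = nb1 k ⊥ k`. [folklore] -/
theorem nb2_dotProduct_self (k : Fin 3 → ℤ) : nb2 k ⬝ᵥ nb2 k = (k ⬝ᵥ k) * (nb1 k ⬝ᵥ nb1 k) := by
  rw [nb2, cross_dot_cross, dotProduct_comm k (nb1 k), nb1_dotProduct, mul_zero, sub_zero]

/-- `nb2 k ≠ 0` for `k ≠ 0`. [folklore] -/
theorem nb2_ne_zero {k : Fin 3 → ℤ} (hk : k ≠ 0) : nb2 k ≠ 0 := fun h => by
  have h2 := nb2_dotProduct_self k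
  rw [h, zero_dotProduct] at h2
  exact mul_ne_zero (dotProduct_self_eq_zero.not.2 hk) (dotProduct_self_eq_zero.not.2 (nb1_ne_zero k))
    h2.symm

/-- `nbv s k ⊥ k`. [folklore] -/
theorem nbv_dotProduct (s : Fin 2) (k : Fin 3 → ℤ) : nbv s k ⬝ᵥ k = 0 := by
  fin_cases s
  · exact nb1_dotProduct k
  · exact nb2_dotProduct k

/-- The cubic coordinate `Σ_{a,b,c} Γ l p q a b c · uₐ v_b w_c` at integer polarisations. [folklore] -/
def cub (Γ : (Fin 3 → ℤ) → (Fin 3 → ℤ) → (Fin 3 → ℤ) → Fin 3 → Fin 3 → Fin 3 → ℂ)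
    (l p q u v w : Fin 3 → ℤ) : ℂ :=
  ∑ a, ∑ b, ∑ c, Γ l p q a b c * (u a : ℂ) * (v b : ℂ) * (w c : ℂ)

/-- The hypotheses of the cubic cores on the coefficient tensor `Γ` over the ball `B`, bundled as a
certificate record (a `Type`-valued bundle of proofs, deliberately not a new proposition of the tree):
symmetry under the slot transpositions, support in `B³`, first-slot transversality, and the polarised
quartet identity (verbatim the cores' clause). [folklore] -/
structure CubicHyp (B : Finset (Fin 3 → ℤ))
    (Γ : (Fin 3 → ℤ) → (Fin 3 → ℤ) → (Fin 3 → ℤ) → Fin 3 → Fin 3 → Fin 3 → ℂ) : Type where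
  /-- symmetry `(1 2)` -/
  symm12 : ∀ p q r a b c, Γ p q r a b c = Γ q p r b a c
  /-- symmetry `(2 3)` -/
  symm23 : ∀ p q r a b c, Γ p q r a b c = Γ p r q a c b
  /-- support in `B × B × B` -/
  supp : ∀ p q r, (p ∉ B ∨ q ∉ B ∨ r ∉ B) → ∀ a b c, Γ p q r a b c = 0
  /-- transversality in the first slot -/
  trans : ∀ p q r b c, ∑ a, Γ p q r a b c * (p a : ℂ) = 0
  /-- the polarised quartet identity -/
  quart : ∀ (w : Fin 4 → Fin 3 → ℤ) (x : Fin 4 → Fin 3 → ℂ), (∀ i, w i ∈ B) →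
    (∀ i, ∑ a, (w i a : ℂ) * x i a = 0) →
    ∑ p ∈ (Finset.univ : Finset (Fin 4 × Fin 4)).filter (fun p => p.1 < p.2),
      ∑ q ∈ (Finset.univ : Finset (Fin 4 × Fin 4)).filter
        (fun q => q.1 < q.2 ∧ q.1 ≠ p.1 ∧ q.1 ≠ p.2 ∧ q.2 ≠ p.1 ∧ q.2 ≠ p.2),
        ∑ a, ∑ b, ∑ c, Γ (w p.1 + w p.2) (w q.1) (w q.2) a b c *
          ((∑ d, x p.1 d * (w p.2 d : ℂ)) * x p.2 a + (∑ d, x p.2 d * (w p.1 d : ℂ)) * x p.1 a) *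
            x q.1 b * x q.2 c = 0

/-- Packaging of the cores' hypothesis lists (sector `θ`; the momentum disjunct is dropped). [folklore] -/
def CubicHyp.of_sector (θ : Fin 3 → ℤ) (h12 : ∀ p q r a b c, Γ p q r a b c = Γ q p r b a c)
    (h23 : ∀ p q r a b c, Γ p q r a b c = Γ p r q a c b)
    (hsupp : ∀ p q r, (p ∉ B ∨ q ∉ B ∨ r ∉ B ∨ p + q + r ≠ θ) → ∀ a b c, Γ p q r a b c = 0)
    (htrans : ∀ p q r b c, ∑ a, Γ p q r a b c * (p a : ℂ) = 0)
    (hquart : ∀ (w : Fin 4 → Fin 3 → ℤ) (x : Fin 4 → Fin 3 → ℂ), (∀ i, w i ∈ B) →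
      (∀ i, ∑ a, (w i a : ℂ) * x i a = 0) →
      ∑ p ∈ (Finset.univ : Finset (Fin 4 × Fin 4)).filter (fun p => p.1 < p.2),
        ∑ q ∈ (Finset.univ : Finset (Fin 4 × Fin 4)).filter
          (fun q => q.1 < q.2 ∧ q.1 ≠ p.1 ∧ q.1 ≠ p.2 ∧ q.2 ≠ p.1 ∧ q.2 ≠ p.2),
          ∑ a, ∑ b, ∑ c, Γ (w p.1 + w p.2) (w q.1) (w q.2) a b c *
            ((∑ d, x p.1 d * (w p.2 d : ℂ)) * x p.2 a + (∑ d, x p.2 d * (w p.1 d : ℂ)) * x p.1 a) *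
              x q.1 b * x q.2 c = 0) : CubicHyp B Γ :=
  ⟨h12, h23, fun p q r h => hsupp p q r (by tauto), htrans, hquart⟩

/-- `CubicHyp` from the hypothesis list of `cubicCoreCentre` (sector `0`). [folklore] -/
def CubicHyp.of_centre (h12 : ∀ p q r a b c, Γ p q r a b c = Γ q p r b a c)
    (h23 : ∀ p q r a b c, Γ p q r a b c = Γ p r q a c b)
    (hsupp : ∀ p q r, (p ∉ B ∨ q ∉ B ∨ r ∉ B ∨ p + q + r ≠ 0) → ∀ a b c, Γ p q r a b c = 0)
    (htrans : ∀ p q r b c, ∑ a, Γ p q r a b c * (p a : ℂ) = 0)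
    (hquart : ∀ (w : Fin 4 → Fin 3 → ℤ) (x : Fin 4 → Fin 3 → ℂ), (∀ i, w i ∈ B) →
      (∀ i, ∑ a, (w i a : ℂ) * x i a = 0) →
      ∑ p ∈ (Finset.univ : Finset (Fin 4 × Fin 4)).filter (fun p => p.1 < p.2),
        ∑ q ∈ (Finset.univ : Finset (Fin 4 × Fin 4)).filter
          (fun q => q.1 < q.2 ∧ q.1 ≠ p.1 ∧ q.1 ≠ p.2 ∧ q.2 ≠ p.1 ∧ q.2 ≠ p.2),
          ∑ a, ∑ b, ∑ c, Γ (w p.1 + w p.2) (w q.1) (w q.2) a b c *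
            ((∑ d, x p.1 d * (w p.2 d : ℂ)) * x p.2 a + (∑ d, x p.2 d * (w p.1 d : ℂ)) * x p.1 a) *
              x q.1 b * x q.2 c = 0) : CubicHyp B Γ :=
  CubicHyp.of_sector 0 h12 h23 hsupp htrans hquart

/-- `CubicHyp` from the hypothesis list of `cubicCoreOffCentre` (sector `(0, m, 0)`). [folklore] -/
def CubicHyp.of_offCentre (m : ℤ) (h12 : ∀ p q r a b c, Γ p q r a b c = Γ q p r b a c)
    (h23 : ∀ p q r a b c, Γ p q r a b c = Γ p r q a c b)
    (hsupp : ∀ p q r, (p ∉ B ∨ q ∉ B ∨ r ∉ B ∨ p + q + r ≠ fun i => if i = 1 then m else 0) →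
      ∀ a b c, Γ p q r a b c = 0)
    (htrans : ∀ p q r b c, ∑ a, Γ p q r a b c * (p a : ℂ) = 0)
    (hquart : ∀ (w : Fin 4 → Fin 3 → ℤ) (x : Fin 4 → Fin 3 → ℂ), (∀ i, w i ∈ B) →
      (∀ i, ∑ a, (w i a : ℂ) * x i a = 0) →
      ∑ p ∈ (Finset.univ : Finset (Fin 4 × Fin 4)).filter (fun p => p.1 < p.2),
        ∑ q ∈ (Finset.univ : Finset (Fin 4 × Fin 4)).filter
          (fun q => q.1 < q.2 ∧ q.1 ≠ p.1 ∧ q.1 ≠ p.2 ∧ q.2 ≠ p.1 ∧ q.2 ≠ p.2),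
          ∑ a, ∑ b, ∑ c, Γ (w p.1 + w p.2) (w q.1) (w q.2) a b c *
            ((∑ d, x p.1 d * (w p.2 d : ℂ)) * x p.2 a + (∑ d, x p.2 d * (w p.1 d : ℂ)) * x p.1 a) *
              x q.1 b * x q.2 c = 0) : CubicHyp B Γ :=
  CubicHyp.of_sector _ h12 h23 hsupp htrans hquart

/-! ## Trilinear sums over `ℂ` (general coefficient block `G`) -/

section sums
variable (G : Fin 3 → Fin 3 → Fin 3 → ℂ)

/-- Expansion of the first slot along three vectors. [folklore] -/
theorem sum3_lin₁ (c₁ c₂ c₃ : ℂ) (n₁ n₂ n₃ y z : Fin 3 → ℂ) :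
    ∑ a, ∑ b, ∑ c, G a b c * (c₁ • n₁ + c₂ • n₂ + c₃ • n₃) a * y b * z c =
      c₁ * ∑ a, ∑ b, ∑ c, G a b c * n₁ a * y b * z c + c₂ * ∑ a, ∑ b, ∑ c, G a b c * n₂ a * y b * z c +
        c₃ * ∑ a, ∑ b, ∑ c, G a b c * n₃ a * y b * z c := by
  simp only [Pi.add_apply, Pi.smul_apply, smul_eq_mul, Finset.mul_sum, ← Finset.sum_add_distrib]
  refine Finset.sum_congr rfl fun a _ => Finset.sum_congr rfl fun b _ =>
    Finset.sum_congr rfl fun c _ => ?_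
  ring

/-- Homogeneity in the first slot. [folklore] -/
theorem sum3_smul₁ (d : ℂ) (x y z : Fin 3 → ℂ) :
    ∑ a, ∑ b, ∑ c, G a b c * (d • x) a * y b * z c = d * ∑ a, ∑ b, ∑ c, G a b c * x a * y b * z c := by
  simp only [Pi.smul_apply, smul_eq_mul, Finset.mul_sum]
  refine Finset.sum_congr rfl fun a _ => Finset.sum_congr rfl fun b _ =>
    Finset.sum_congr rfl fun c _ => ?_
  ring

/-- Exchange of the first two slots. [folklore] -/
theorem sum3_swap12 (x y z : Fin 3 → ℂ) : ∑ a, ∑ b, ∑ c, G a b c * x a * y b * z c =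
    ∑ a, ∑ b, ∑ c, G b a c * y a * x b * z c :=
  Finset.sum_comm.trans (Finset.sum_congr rfl fun a _ => Finset.sum_congr rfl fun b _ =>
    Finset.sum_congr rfl fun c _ => by ring)

/-- Exchange of the last two slots. [folklore] -/
theorem sum3_swap23 (x y z : Fin 3 → ℂ) : ∑ a, ∑ b, ∑ c, G a b c * x a * y b * z c =
    ∑ a, ∑ b, ∑ c, G a c b * x a * z b * y c :=
  Finset.sum_congr rfl fun a _ => Finset.sum_comm.trans (Finset.sum_congr rfl fun b _ =>
    Finset.sum_congr rfl fun c _ => by ring)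

/-- Factoring the first-slot contraction. [folklore] -/
theorem sum3_factor₁ (x y z : Fin 3 → ℂ) : ∑ a, ∑ b, ∑ c, G a b c * x a * y b * z c =
    ∑ b, ∑ c, (∑ a, G a b c * x a) * (y b * z c) :=
  Finset.sum_comm.trans (Finset.sum_congr rfl fun b _ => Finset.sum_comm.trans
    (Finset.sum_congr rfl fun c _ => by rw [Finset.sum_mul]; exact Finset.sum_congr rfl fun a _ => by ring))

end sums

/-- Integer dot products cast to `ℂ`. [folklore] -/
theorem intCast_dotProduct (u v : Fin 3 → ℤ) :
    ((u ⬝ᵥ v : ℤ) : ℂ) = (fun i => (u i : ℂ)) ⬝ᵥ (fun i => (v i : ℂ)) := by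
  simp [dotProduct]

/-- Integer cross products cast to `ℂ`. [folklore] -/
theorem intCast_cross (u v : Fin 3 → ℤ) :
    (fun i => ((u ⨯₃ v) i : ℂ)) = (fun i => (u i : ℂ)) ⨯₃ (fun i => (v i : ℂ)) := by
  funext i; fin_cases i <;> simp [cross_apply]

/-- **Orthogonal expansion along `n`, `l × n`, `l`** (`n ⊥ l`, any commutative ring, no division):
`(n·n)(l·l) t = (t·n)(l·l) n + (t·(l×n)) (l×n) + (t·l)(n·n) l`. [folklore] -/
theorem proj_identity {R : Type*} [CommRing R] (l n t : Fin 3 → R) (h : n ⬝ᵥ l = 0) :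
    ((n ⬝ᵥ n) * (l ⬝ᵥ l)) • t =
      ((t ⬝ᵥ n) * (l ⬝ᵥ l)) • n + (t ⬝ᵥ (l ⨯₃ n)) • (l ⨯₃ n) + ((t ⬝ᵥ l) * (n ⬝ᵥ n)) • l := by
  have key : ((n ⬝ᵥ n) * (l ⬝ᵥ l)) • t =
      ((t ⬝ᵥ n) * (l ⬝ᵥ l)) • n + (t ⬝ᵥ (l ⨯₃ n)) • (l ⨯₃ n) + ((t ⬝ᵥ l) * (n ⬝ᵥ n)) • l
        + (n ⬝ᵥ l) • ((n ⬝ᵥ l) • t - (t ⬝ᵥ n) • l - (l ⬝ᵥ t) • n) := by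
    ext i
    fin_cases i <;>
      simp only [Pi.add_apply, Pi.smul_apply, Pi.sub_apply, smul_eq_mul, vec3_dotProduct,
        cross_apply, cons_val_zero, cons_val_one, cons_val_two, head_cons, tail_cons,
        Fin.reduceFinMk, Fin.isValue] <;> ring
  rw [key, h, zero_smul, add_zero]

/-! ## `cub` algebra -/

/-- Symmetry of `cub` under `(1 2)` (legs together with their polarisations). [folklore] -/
theorem cub_swap12 (H : CubicHyp B Γ) (l p q u v w : Fin 3 → ℤ) :
    cub Γ l p q u v w = cub Γ p l q v u w := by
  unfold cub; rw [sum3_swap12 (Γ p l q)]; simp_rw [H.symm12 l p q]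

/-- Symmetric under `(2 3)`. [folklore] -/
theorem cub_swap23 (H : CubicHyp B Γ) (l p q u v w : Fin 3 → ℤ) :
    cub Γ l p q u v w = cub Γ l q p u w v := by
  unfold cub; rw [sum3_swap23 (Γ l q p)]; simp_rw [H.symm23 l p q]

/-- `cub` vanishes at `u = 0`. [folklore] -/
@[simp] theorem cub_zero₁ (l p q v w : Fin 3 → ℤ) : cub Γ l p q 0 v w = 0 := by simp [cub]

/-- `cub` vanishes at `v = 0`. [folklore] -/
@[simp] theorem cub_zero₂ (l p q u w : Fin 3 → ℤ) : cub Γ l p q u 0 w = 0 := by simp [cub]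

/-- `cub` vanishes at `w = 0`. [folklore] -/
@[simp] theorem cub_zero₃ (l p q u v : Fin 3 → ℤ) : cub Γ l p q u v 0 = 0 := by simp [cub]

/-- Support: a leg outside `B` kills the coordinate. [folklore] -/
theorem cub_supp (H : CubicHyp B Γ) {l p q : Fin 3 → ℤ} (h : l ∉ B ∨ p ∉ B ∨ q ∉ B)
    (u v w : Fin 3 → ℤ) : cub Γ l p q u v w = 0 := by
  simp [cub, H.supp l p q h]

/-- Additivity in slot 1. [folklore] -/
theorem cub_add₁ (l p q u u' v w : Fin 3 → ℤ) :
    cub Γ l p q (u + u') v w = cub Γ l p q u v w + cub Γ l p q u' v w := by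
  simp only [cub, Pi.add_apply, Int.cast_add, ← Finset.sum_add_distrib]
  exact Finset.sum_congr rfl fun a _ => Finset.sum_congr rfl fun b _ =>
    Finset.sum_congr rfl fun c _ => by ring

/-- Homogeneity in slot 1. [folklore] -/
theorem cub_smul₁ (c : ℤ) (l p q u v w : Fin 3 → ℤ) :
    cub Γ l p q (c • u) v w = (c : ℂ) * cub Γ l p q u v w := by
  simp only [cub, Pi.smul_apply, smul_eq_mul, Int.cast_mul, Finset.mul_sum]
  exact Finset.sum_congr rfl fun a _ => Finset.sum_congr rfl fun b _ =>
    Finset.sum_congr rfl fun c _ => by ring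

/-- Additivity in slot 2. [folklore] -/
theorem cub_add₂ (l p q u v v' w : Fin 3 → ℤ) :
    cub Γ l p q u (v + v') w = cub Γ l p q u v w + cub Γ l p q u v' w := by
  simp only [cub, Pi.add_apply, Int.cast_add, ← Finset.sum_add_distrib]
  exact Finset.sum_congr rfl fun a _ => Finset.sum_congr rfl fun b _ =>
    Finset.sum_congr rfl fun c _ => by ring

/-- Homogeneity in slot 2. [folklore] -/
theorem cub_smul₂ (c : ℤ) (l p q u v w : Fin 3 → ℤ) :
    cub Γ l p q u (c • v) w = (c : ℂ) * cub Γ l p q u v w := by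
  simp only [cub, Pi.smul_apply, smul_eq_mul, Int.cast_mul, Finset.mul_sum]
  exact Finset.sum_congr rfl fun a _ => Finset.sum_congr rfl fun b _ =>
    Finset.sum_congr rfl fun c _ => by ring

/-- Additivity in slot 3. [folklore] -/
theorem cub_add₃ (l p q u v w w' : Fin 3 → ℤ) :
    cub Γ l p q u v (w + w') = cub Γ l p q u v w + cub Γ l p q u v w' := by
  simp only [cub, Pi.add_apply, Int.cast_add, ← Finset.sum_add_distrib]
  exact Finset.sum_congr rfl fun a _ => Finset.sum_congr rfl fun b _ =>
    Finset.sum_congr rfl fun c _ => by ring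

/-- Homogeneity in slot 3. [folklore] -/
theorem cub_smul₃ (c : ℤ) (l p q u v w : Fin 3 → ℤ) :
    cub Γ l p q u v (c • w) = (c : ℂ) * cub Γ l p q u v w := by
  simp only [cub, Pi.smul_apply, smul_eq_mul, Int.cast_mul, Finset.mul_sum]
  exact Finset.sum_congr rfl fun a _ => Finset.sum_congr rfl fun b _ =>
    Finset.sum_congr rfl fun c _ => by ring

/-- Transversality: `cub Γ l p q l v w = 0`. [folklore] -/
theorem cub_self₁ (H : CubicHyp B Γ) (l p q v w : Fin 3 → ℤ) : cub Γ l p q l v w = 0 := by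
  unfold cub; rw [sum3_factor₁]; simp [H.trans]

/-- Transversality in slot 2. [folklore] -/
theorem cub_self₂ (H : CubicHyp B Γ) (l p q u w : Fin 3 → ℤ) : cub Γ l p q u p w = 0 := by
  rw [cub_swap12 H]; exact cub_self₁ H p l q u w

/-- Transversality in slot 3. [folklore] -/
theorem cub_self₃ (H : CubicHyp B Γ) (l p q u v : Fin 3 → ℤ) : cub Γ l p q u v q = 0 := by
  rw [cub_swap23 H, cub_swap12 H]; exact cub_self₁ H q l p u v

/-- The orthogonal expansion pushed through `cub` (no division). [folklore] -/
theorem cub_expand_aux (l p q τ v w : Fin 3 → ℤ) :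
    ((nb1 l ⬝ᵥ nb1 l : ℤ) : ℂ) * ((l ⬝ᵥ l : ℤ) : ℂ) * cub Γ l p q τ v w =
      ((τ ⬝ᵥ nb1 l : ℤ) : ℂ) * ((l ⬝ᵥ l : ℤ) : ℂ) * cub Γ l p q (nb1 l) v w +
      ((τ ⬝ᵥ nb2 l : ℤ) : ℂ) * cub Γ l p q (nb2 l) v w +
      ((τ ⬝ᵥ l : ℤ) : ℂ) * ((nb1 l ⬝ᵥ nb1 l : ℤ) : ℂ) * cub Γ l p q l v w := by
  have hid := congrArg (fun u => cub Γ l p q u v w) (proj_identity l (nb1 l) τ (nb1_dotProduct l))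
  simp only [cub_add₁, cub_smul₁, Int.cast_mul] at hid
  rw [← nb2] at hid
  linear_combination hid

/-- **First-slot expansion in the `nb` basis** (the anchor): for `l ≠ 0`,
`cub Γ l p q τ v w = (τ·n₁)/(n₁·n₁) cub(…n₁…) + (τ·n₂)/(n₂·n₂) cub(…n₂…)`, `nᵢ = nbᵢ l`. [folklore] -/
theorem cub_expand₁ (H : CubicHyp B Γ) {l : Fin 3 → ℤ} (hl : l ≠ 0) (p q τ v w : Fin 3 → ℤ) :
    cub Γ l p q τ v w = ((τ ⬝ᵥ nb1 l : ℤ) : ℂ) / ((nb1 l ⬝ᵥ nb1 l : ℤ) : ℂ) * cub Γ l p q (nb1 l) v w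
      + ((τ ⬝ᵥ nb2 l : ℤ) : ℂ) / ((nb2 l ⬝ᵥ nb2 l : ℤ) : ℂ) * cub Γ l p q (nb2 l) v w := by
  have hn : ((nb1 l ⬝ᵥ nb1 l : ℤ) : ℂ) ≠ 0 := by
    exact_mod_cast dotProduct_self_eq_zero.not.2 (nb1_ne_zero l)
  have hl' : ((l ⬝ᵥ l : ℤ) : ℂ) ≠ 0 := by exact_mod_cast dotProduct_self_eq_zero.not.2 hl
  have key := cub_expand_aux (Γ := Γ) l p q τ v w
  rw [cub_self₁ H, mul_zero, add_zero] at key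
  rw [nb2_dotProduct_self, Int.cast_mul]
  field_simp
  linear_combination key

/-- First-slot expansion when `l = 0` only occurs together with `τ = 0`. [folklore] -/
theorem cub_expand₁_of (H : CubicHyp B Γ) (l p q τ v w : Fin 3 → ℤ) (h0 : l = 0 → τ = 0) :
    cub Γ l p q τ v w = ((τ ⬝ᵥ nb1 l : ℤ) : ℂ) / ((nb1 l ⬝ᵥ nb1 l : ℤ) : ℂ) * cub Γ l p q (nb1 l) v w
      + ((τ ⬝ᵥ nb2 l : ℤ) : ℂ) / ((nb2 l ⬝ᵥ nb2 l : ℤ) : ℂ) * cub Γ l p q (nb2 l) v w := by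
  by_cases hτ : τ = 0
  · subst hτ; simp
  · exact cub_expand₁ H (fun hl => hτ (h0 hl)) p q τ v w

/-- Registered anchor of this file on stmt-AnomalousDissipation-11464: the closed form of `cub_expand₁`.
[folklore] -/
theorem cubicCoord_expand : ∀ (B : Finset (Fin 3 → ℤ))
    (Γ : (Fin 3 → ℤ) → (Fin 3 → ℤ) → (Fin 3 → ℤ) → Fin 3 → Fin 3 → Fin 3 → ℂ), CubicHyp B Γ →
    ∀ (l : Fin 3 → ℤ), l ≠ 0 → ∀ (p q τ v w : Fin 3 → ℤ),
    cub Γ l p q τ v w = ((τ ⬝ᵥ nb1 l : ℤ) : ℂ) / ((nb1 l ⬝ᵥ nb1 l : ℤ) : ℂ) * cub Γ l p q (nb1 l) v w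
      + ((τ ⬝ᵥ nb2 l : ℤ) : ℂ) / ((nb2 l ⬝ᵥ nb2 l : ℤ) : ℂ) * cub Γ l p q (nb2 l) v w :=
  fun _ _ H _ hl p q τ v w => cub_expand₁ H hl p q τ v w

end Summit.AnomalousDissipation.AnomalousDissipation.Theorems.MomentParityQuarticGate
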